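import Mathlib.NumberTheory.NumberField.Basic
import Mathlib.RingTheory.Coprime.Basic
import Mathlib.GroupTheory.Finiteness
import HarnessLib

/-!
# Chevalley 1951, Théorème 1: congruence conditions forcing `m`-th powers in a finitely generated
subgroup of `Kˣ` (in particular in the unit group of a number field)

One NAMED FACT (D-0014: `def … : Prop`, nothing proved) from C. Chevalley, *Deux théorèmes
d'arithmétique*, J. Math. Soc. Japan **3** (1951) 36–44, Théorème 1 [ChevalleyDeuxTheoremes1951],
together with its specialisation to the unit group, which is the form used in practice
("every subgroup of finite index of `𝓞_Kˣ` contains a congruence subgroup", the input of Weil's /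
Serre's construction of Hecke characters of prescribed type).

Printed statement (Théorème 1, p. 36): "Soient `K` un corps de nombres algébriques de degré fini, et
`E` un sous-groupe à engendrement fini du groupe multiplicatif des éléments `≠ 0` de `K`. Soit `m` un
entier `> 0`, et soit `N` un entier rationnel quelconque. Il existe un entier rationnel `a`, premier à
`N`, qui jouit de la propriété suivante: tout élément `x` de `E` qui est `≡ 1 (mod a)` est puissance
`m`-ième d'un élément de `E`. La condition `x ≡ 1 (mod a)` doit s'interpréter au sens des congruences
multiplicatives de H. Hasse; elle signifie que `x - 1` est de la forme `a y / z` où `y` et `z` sont des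
entiers de `K` et `z` est premier à `a`."  (The paper notes on the same page that the unit group of
`K` is finitely generated, so the theorem applies to `E = 𝓞_Kˣ`.)

Typing choices.  `a` is taken a positive natural number (the sign of a rational integer modulus is
immaterial) and `N` a positive natural number; "`z` premier à `a`" is element coprimality
`IsCoprime (z : 𝓞 K) (a : 𝓞 K)` (`∃ r s, r z + s a = 1`, i.e. the ideals `(z)` and `(a)` are
comaximal, the meaning in a Dedekind domain); we also record `z ≠ 0` so that the quotient is a
genuine one.  For an algebraic INTEGER `x` (in particular a unit) the multiplicative congruence
`x ≡ 1 (mod a)` is equivalent to `a ∣ x - 1` in `𝓞 K` (if `z (x-1) = a y` with `(z) + (a) = (1)`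
then `x - 1 ∈ (a)`), which is how the unit-group specialisation `thm1_units` is phrased.

Why here: grounds the Hecke-character step of
`Summit.Langlands.Langlands.Theses.IrreducibilityBySelfDuality.RegularTwistCM`
(stmt-Langlands-14069: a character of `K_∞ˣ` trivial on the squares of a finite-index subgroup of
units is trivial on a congruence subgroup of units, hence extends to a Hecke character); it is a
hypothesis a prover takes as `(h : Chevalley1951.thm1_units)`, not the item itself.
-/

namespace Literature.NumberTheory.NumberFields

open scoped NumberField

/-- **Chevalley 1951, Théorème 1 (as printed).** Let `K` be a number field and `E` a finitely
generated subgroup of `Kˣ`; let `m > 0` and let `N` be any (here: positive) rational integer. Then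
there is a rational integer `a > 0` prime to `N` such that every `x ∈ E` with `x ≡ 1 (mod a)` in the
sense of Hasse's multiplicative congruences — `x - 1 = a·y/z` with `y, z` integers of `K`, `z ≠ 0`
prime to `a` — is the `m`-th power of an element of `E`.
Grounds `Summit.Langlands.Langlands.Theses.IrreducibilityBySelfDuality.RegularTwistCM` (as a
hypothesis). [cite: ChevalleyDeuxTheoremes1951, Thm 1 (p. 36)] -/
def Chevalley1951.thm1 : Prop :=
  ∀ (K : Type) [Field K] [NumberField K] (E : Subgroup Kˣ), E.FG →
    ∀ (m : ℕ), 0 < m → ∀ (N : ℕ), 0 < N →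
      ∃ a : ℕ, 0 < a ∧ Nat.Coprime a N ∧
        ∀ x : Kˣ, x ∈ E →
          (∃ y z : 𝓞 K, (z : K) ≠ 0 ∧ IsCoprime z (a : 𝓞 K) ∧
              (x : K) - 1 = (a : K) * (y : K) / (z : K)) →
            ∃ w : Kˣ, w ∈ E ∧ x = w ^ m

/-- **Chevalley 1951, Théorème 1, for the unit group** (`E = 𝓞_Kˣ`, finitely generated by
Dirichlet's unit theorem, as the paper remarks on p. 36; for an algebraic integer the multiplicative
congruence `x ≡ 1 (mod a)` is `a ∣ x - 1` in `𝓞 K`): for every number field `K`, every `m > 0` and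
every `N > 0` there is `a > 0` prime to `N` such that every unit `u` with `a ∣ u - 1` is the `m`-th
power of a unit.  Equivalently: the subgroup of `m`-th powers — hence every subgroup of finite index
of `𝓞_Kˣ` — contains the congruence subgroup of level `a` for suitable `a` prime to any given `N`.
Grounds `Summit.Langlands.Langlands.Theses.IrreducibilityBySelfDuality.RegularTwistCM` (as a
hypothesis). [cite: ChevalleyDeuxTheoremes1951, Thm 1 (p. 36), case E = unit group] -/
def Chevalley1951.thm1_units : Prop :=
  ∀ (K : Type) [Field K] [NumberField K] (m : ℕ), 0 < m → ∀ (N : ℕ), 0 < N →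
    ∃ a : ℕ, 0 < a ∧ Nat.Coprime a N ∧
      ∀ u : (𝓞 K)ˣ, (a : 𝓞 K) ∣ (u : 𝓞 K) - 1 → ∃ w : (𝓞 K)ˣ, u = w ^ m

end Literature.NumberTheory.NumberFields
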